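import Summits.HubbardSuperconductivity.HubbardSuperconductivity.Theorems.BalabanIRBirComplexStableXYRSplitGlueR3
import Summits.HubbardSuperconductivity.HubbardSuperconductivity.Theorems.BalabanIRBirComplexStableXYRStubCubicNormalForm
import Summits.HubbardSuperconductivity.HubbardSuperconductivity.Theorems.BirComplexStableXY.Negative.WitnessTable
import HarnessLib

/-!
# BalabanIR crux 2R `BirComplexStableXYR` (stmt-HubbardSuperconductivity-14845): the crux follows from the engine
# stated on the REAL-HESSIAN subclass (I3) — the composition of line `fat-gaussian-defect-calculus` as a tree theorem

Line `fat-gaussian-defect-calculus`, line lead c5 (skeleton `Cruxes/BirComplexStableXYR/Lines/fat_gaussian_defect_calculus.lean`).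
The line's only open stub `stub_singleRegimeRG` is, once fed with its five landed scale-0 inputs, the statement
`SingleRegimeI3` below: the engine's two outputs (`0 < Re Z` and the slice-averaged two-point deficit
`Re ∫ D e^{−A} ≤ C/(c₀K)·Re Z`, `D = L⁻⁴ Σ_{x,y}(1 − cos(θ_{x,0} − θ_{y,0}))`) for `K ≥ K₀(r,B,c₀)`, even `L₀ ≤ L ≤ M`,
on the admissible tables that in addition have a REAL window Hessian, (I3) `Σ_n Im(c_n)(n·v)² = 0`.

This file makes the skeleton's composition permanent, so that the promoted statement closes the crux by a one-line
application:

* `srg_of_I3` : `SingleRegimeI3 → SingleRegime` — hypothesis (I3) is removed by the landed cubic normal form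
  `FatGaussian.stub_cubicNormalForm` (p127699): every (U1)(R)(P) table `c` has an in-class re-tabling `c'` with the SAME
  action on every torus (hence the same `Z` and the same deficit integral), (U1)(N)(R)(P) kept, `normA c' ≤ C_r·normA c`,
  the same `Re F` (so (C) is kept) and a real window Hessian; the budget fed to the (I3) statement is `C_r·B`.
* `birComplexStableXYR_of_singleRegimeI3` : `SingleRegimeI3 → BirComplexStableXYR` — through the landed split glue
  `stub_splitGlueR3` (p120778: positivity child used at `r ≥ 3`, deficit child at `r ≥ 2`, `Im Z = 0` by (R)-reality,
  threshold `K ≥ 2C/c₀`).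

Both hypotheses are written out as explicit Prop-valued binders in the vocabulary of
`Theorems.BirComplexStableXY.Negative.WitnessTable` (`Table`, `normA`, `genF`, `action`, `partZ`, `cube`); nothing is
restated as a definition. [folklore]
-/

set_option linter.dupNamespace false -- summit = problem name (single-conjunct summit), D-0017

noncomputable section

namespace Summit.HubbardSuperconductivity.HubbardSuperconductivity.Theorems

open scoped BigOperators ComplexConjugate
open MeasureTheory Literature.Probability.LatticeModels
open Summit.HubbardSuperconductivity.BirComplexStableXYNegative
open Summit.HubbardSuperconductivity.HubbardSuperconductivity.Theses.BalabanIR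

section SingleRegimeGlue

/-- **(I3) is without loss of generality.**  If the engine's two outputs hold on the (I3) subclass (real window Hessian)
of the admissible (U1)(N)(A)(C)(R)(P) tables, with thresholds depending only on `(r, B, c₀)`, then they hold on the
whole admissible class: apply the hypothesis with budget `C_r·B` to the cubic normal form `c'` of `c`
(`FatGaussian.stub_cubicNormalForm`), which has the same action, hence the same `Z` and the same deficit integral.
[folklore] -/
theorem srg_of_I3
    (h : ∀ (r : ℕ) (B c₀ : ℝ), 2 ≤ r → 0 < c₀ → ∃ K₀ : ℝ, ∃ L₀ : ℕ, ∃ C : ℝ, ∀ K : ℝ, K₀ ≤ K → ∀ c : Table r, (∀ n ∈ c.support, ∑ w, n w = 0) → c.sum (fun _ a => a) = 0 → normA c ≤ B → (∀ φ : W r → ℝ, c₀ * ∑ w, ∑ w', (1 - Real.cos (φ w - φ w')) ≤ (genF c φ).re) → (∀ n : Freq r, c (fun w => n (w.1, w.2.1, Fin.rev w.2.2)) = (starRingEnd ℂ) (c (-n))) → (∀ n : Freq r, c (fun w => n (Fin.rev w.1, Fin.rev w.2.1, w.2.2)) = c n) → (∀ v : W r → ℝ, c.sum (fun n a => a.im *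 (∑ w, (n w : ℝ) * v w) ^ 2) = 0) → ∀ (L M : ℕ) [NeZero L] [NeZero M], L₀ ≤ L → L ≤ M → Even L → Even M → 0 < (partZ K c L M).re ∧ (∫ θ in cube L M, (((∑ x : TorusSite 2 L, ∑ y : TorusSite 2 L, (1 - Real.cos (θ (x, 0) - θ (y, 0)))) / (L : ℝ) ^ 4 : ℝ) : ℂ) * Complex.exp (-(action K c L M θ))).re ≤ C / (c₀ * K) * (partZ K c L M).re)
    (r : ℕ) (B c₀ : ℝ) (hr : 2 ≤ r) (hc₀ : 0 < c₀) :
    ∃ K₀ : ℝ, ∃ L₀ : ℕ, ∃ C : ℝ, ∀ K : ℝ, K₀ ≤ K → ∀ c : Table r, (∀ n ∈ c.support, ∑ w, n w = 0) → c.sum (fun _ a => a) = 0 → normA c ≤ B → (∀ φ : W r → ℝ, c₀ * ∑ w, ∑ w', (1 - Real.cos (φ w - φ w')) ≤ (genF c φ).re) → (∀ n : Freq r, c (fun w => n (w.1, w.2.1, Fin.rev w.2.2)) = (starRingEnd ℂ) (c (-n))) → (∀ n : Freq r, c (fun w => n (Fin.rev w.1, Fin.rev w.2.1, w.2.2)) =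 c n) → ∀ (L M : ℕ) [NeZero L] [NeZero M], L₀ ≤ L → L ≤ M → Even L → Even M → 0 < (partZ K c L M).re ∧ (∫ θ in cube L M, (((∑ x : TorusSite 2 L, ∑ y : TorusSite 2 L, (1 - Real.cos (θ (x, 0) - θ (y, 0)))) / (L : ℝ) ^ 4 : ℝ) : ℂ) * Complex.exp (-(action K c L M θ))).re ≤ C / (c₀ * K) * (partZ K c L M).re := by
  obtain ⟨Cr, -, hCr⟩ := FatGaussian.stub_cubicNormalForm r
  obtain ⟨K₀, L₀, C, H⟩ := h r (Cr * B) c₀ hr hc₀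
  refine ⟨K₀, L₀, C, ?_⟩
  intro K hK c hU1 hN hA hC hR hP L M _ _ hL hLM hLe hMe
  obtain ⟨c', hU1', hR', hP', hN', hA', hRe', hAct', hI3'⟩ := hCr c hU1 hR hP
  have hC' : ∀ φ : W r → ℝ, c₀ * ∑ w, ∑ w', (1 - Real.cos (φ w - φ w')) ≤ (genF c' φ).re := by
    intro φ; rw [hRe' φ]; exact hC φ
  have key := H K hK c' hU1' (hN' hN) (hA' B hA) hC' hR' hP' hI3' L M hL hLM hLe hMe
  have hact : ∀ θ : Λ L M → ℝ, action K c' L M θ = action K c L M θ := fun θ => hAct' K L M θ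
  simp only [partZ, hact] at key
  simpa only [partZ] using key

/-- **The crux from the engine on the (I3) subclass.**  `SingleRegimeI3 → BalabanIR.BirComplexStableXYR`: remove (I3)
by `srg_of_I3`, then apply the landed split glue `stub_splitGlueR3` (positivity child at `r ≥ 3`, deficit child at
`r ≥ 2`; `Im Z = 0` by (R)-reality and the threshold `K ≥ 2C/c₀` are inside the glue).  This is the composition
`BirComplexStableXYR_of` of the line skeleton `Lines/fat_gaussian_defect_calculus.lean` with its one open stub as the
hypothesis. [folklore] -/
theorem birComplexStableXYR_of_singleRegimeI3 :
    (∀ (r : ℕ) (B c₀ : ℝ), 2 ≤ r → 0 < c₀ → ∃ K₀ : ℝ, ∃ L₀ : ℕ, ∃ C : ℝ, ∀ K : ℝ, K₀ ≤ K → ∀ c : Table r, (∀ n ∈ c.support, ∑ w, n w = 0) → c.sum (fun _ a => a) = 0 → normA c ≤ B → (∀ φ : W r → ℝ, c₀ * ∑ w, ∑ w', (1 - Real.cos (φ w - φ w')) ≤ (genF c φ).re) → (∀ n : Freq r, c (fun w => n (w.1, w.2.1, Fin.rev w.2.2)) = (starRingEnd ℂ) (c (-n))) → (∀ n : Freq r,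 c (fun w => n (Fin.rev w.1, Fin.rev w.2.1, w.2.2)) = c n) → (∀ v : W r → ℝ, c.sum (fun n a => a.im * (∑ w, (n w : ℝ) * v w) ^ 2) = 0) → ∀ (L M : ℕ) [NeZero L] [NeZero M], L₀ ≤ L → L ≤ M → Even L → Even M → 0 < (partZ K c L M).re ∧ (∫ θ in cube L M, (((∑ x : TorusSite 2 L, ∑ y : TorusSite 2 L, (1 - Real.cos (θ (x, 0) - θ (y, 0)))) / (L : ℝ) ^ 4 : ℝ) : ℂ) * Complex.exp (-(action K c L M θ))).re ≤ C / (c₀ * K) * (partZ K c L M).re) →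
    BirComplexStableXYR := by
  intro h
  refine stub_splitGlueR3 ?_ ?_
  · intro r B c₀ hr hc₀
    obtain ⟨K₀, L₀, C, H⟩ := srg_of_I3 h r B c₀ (by omega) hc₀
    refine ⟨K₀, L₀, ?_⟩
    intro K hK c hU1 hN hA hC hR hP L M _ _ hL hLM hLe hMe
    have key := (H K hK c hU1 hN hA hC hR hP L M hL hLM hLe hMe).1
    dsimp only [partZ, action, genF, sh, cube] at key
    dsimp only
    exact key
  · intro r B c₀ hr hc₀
    obtain ⟨K₀, L₀, C, H⟩ := srg_of_I3 h r B c₀ hr hc₀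
    refine ⟨K₀, L₀, C, ?_⟩
    intro K hK c hU1 hN hA hC hR hP L M _ _ hL hLM hLe hMe
    have key := (H K hK c hU1 hN hA hC hR hP L M hL hLM hLe hMe).2
    dsimp only [partZ, action, genF, sh, cube] at key
    dsimp only
    exact key

end SingleRegimeGlue

end Summit.HubbardSuperconductivity.HubbardSuperconductivity.Theorems

end
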